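import Literature.Computability.Complexity.OccurrenceObstructionsIPProofs
import HarnessLib

/-!
# Ikenmeyer–Panova 2017: Cor. 1.6 (degree lower bound) discharged, and IP Thm. 1.4 from two facts

Sibling proofs file of `Literature/Computability/Complexity/OccurrenceObstructionsIP.lean` (statements)
and `OccurrenceObstructionsIPProofs.lean` (which discharges IP Prop. 2.8,
`ikenmeyerPanova2017_prop_2_8_holds`, and the transposition property). Theorems only; no statement
of the tree is changed. Letters as there: `n` = permanent size, `m` = determinant size, `d` = outer
degree, everything over `ℂ`.

1. **IP Cor. 1.6 is a theorem** (`ikenmeyerPanova2017_cor_1_6_holds`): "If `|λ̄| ≤ md` with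
   `a_λ(d[n]) > g(λ, n × d, n × d)`, then `d > n/m`" — IP's printed proof (§2.2, held p. 7: "By
   Prop. 2.8 we have `(n, d) ∉ St¹(λ̄)`, so `|λ̄| > n`. Thus `dm ≥ |λ̄| > n` and therefore `d > n/m`")
   is the tree theorem `ikenmeyerPanova2017_cor_1_6_of_prop_2_8`, and Prop. 2.8 is now the tree
   theorem `ikenmeyerPanova2017_prop_2_8_holds` (uniform Valiant size, Kadish–Landsberg lifting,
   the algebraic Peter–Weyl bound, and Manivel's stability `kroneckerCoeff_rowLift_le`).
2. **Consequences.** Every conditional theorem of the two sibling files carrying the hypotheses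
   `(h16 : ikenmeyerPanova2017_cor_1_6)` or `(h28 : ikenmeyerPanova2017_prop_2_8)` is restated
   without them: after this file, **IP Thm. 1.4 (for IP's own padding, `ikenmeyerPanova2017_thm_1_4`)
   rests on exactly two named facts of IP's paper — Thm. 1.7(a) (the six exceptional bodies do not
   occur in `Sym^d Sym^m V`) and Thm. 4.6 (main Kronecker positivity)** — for every permanent size
   `n ≥ 1` outside the single window `n = 2`, `48 < m < 243` not covered by any printed argument
   (`ikenmeyerPanova2017_thm_1_4_of_two_facts`; for `n ≥ 3` verbatim,
   `ikenmeyerPanova2017_thm_1_4_of_two_facts_three_le`; the printed route through Cor. 1.6 and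
   Thm. 1.7(b), `ikenmeyerPanova2017_thm_1_4_of_thm_1_7`), and likewise the two statements the
   printed parts deliver for G20's fresh-variable padding (`paddedPerOrbitRep`, thresholds
   `3·max(n²+1, 9)² ≤ m` and `3(n+1)^4 < m`).

Source: C. Ikenmeyer, G. Panova, *Rectangular Kronecker coefficients and plethysms in geometric
complexity theory*, Adv. Math. 319 (2017) 40–66 = arXiv:1512.03798, §1.1 (Cor. 1.6, Thm. 1.4 and
its proof, held text pp. 4–5), §2.2 (proof of Cor. 1.6, held p. 7). Key `IkenmeyerPanova2017`.
-/

noncomputable section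

namespace Literature.Computability.Complexity

/-! ### IP Cor. 1.6 (degree lower bound) is a theorem -/

/-- **Discharge of `ikenmeyerPanova2017_cor_1_6` (IP Cor. 1.6 = held Cor. 6, degree lower
bound).** "If `|λ̄| ≤ md` with `a_λ(d[n]) > g(λ, n × d, n × d)`, then `d > n/m`": IP's proof (§2.2,
held p. 7) from Prop. 2.8 — the tree theorem `ikenmeyerPanova2017_cor_1_6_of_prop_2_8` — applied to
the discharged Prop. 2.8, `ikenmeyerPanova2017_prop_2_8_holds`.
[cite: IkenmeyerPanova2017, Cor. 1.6 (held: Cor. 6) and §2.2 (Proof of Cor. 1.6; held p. 7)] -/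
theorem ikenmeyerPanova2017_cor_1_6_holds : ikenmeyerPanova2017_cor_1_6 :=
  ikenmeyerPanova2017_cor_1_6_of_prop_2_8 ikenmeyerPanova2017_prop_2_8_holds

/-! ### IP Thm. 1.4 from the two remaining facts: Thm. 1.7(a) and Thm. 4.6 -/

/-- **IP Thm. 1.4 (`ikenmeyerPanova2017_thm_1_4`, IP's padding, threshold `3n^4 < m`) from
Thm. 1.7(a) and Thm. 4.6 alone, for every `0 < n` outside the window `n = 2`, `48 < m < 243`**
(the only part of the printed statement not covered by a printed argument): the tree theorem
`ikenmeyerPanova2017_thm_1_4_of_three_facts` with Prop. 2.8 discharged.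
[cite: IkenmeyerPanova2017, Thm. 1.4 (held: Thm. 4) and §1.1 (Proof of Thm. 1.4; held p. 5)] -/
theorem ikenmeyerPanova2017_thm_1_4_of_two_facts (h17a : ikenmeyerPanova2017_thm_1_7a)
    (h46 : ikenmeyerPanova2017_thm_4_6) {n m d : ℕ} [NeZero m] (hn0 : 0 < n) (hnm : 3 * n ^ 4 < m)
    (h2 : n = 2 → 243 ≤ m) (lam : Nat.Partition (m * d)) (hlam : lam.parts.card ≤ m * m)
    (h : Literature.NumberTheory.DiophantineGeometry.HasHighestWeight
      (Complexity.bipPaddedPerOrbitRep ℂ n m) (partitionWeightLex m lam)) :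
    0 < Literature.NumberTheory.DiophantineGeometry.kroneckerCoeff ℂ lam (Nat.Partition.rectangle m d)
      (Nat.Partition.rectangle m d) :=
  ikenmeyerPanova2017_thm_1_4_of_three_facts ikenmeyerPanova2017_prop_2_8_holds h17a h46 hn0 hnm h2
    lam hlam h

/-- **IP Thm. 1.4 verbatim for permanent size `n ≥ 3`** — the range of the printed proof — from
Thm. 1.7(a) and Thm. 4.6 only: once these two named facts are discharged, this is
`ikenmeyerPanova2017_thm_1_4` restricted to `3 ≤ n`.
[cite: IkenmeyerPanova2017, Thm. 1.4 (held: Thm. 4) and §1.1 (Proof of Thm. 1.4; held p. 5)] -/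
theorem ikenmeyerPanova2017_thm_1_4_of_two_facts_three_le (h17a : ikenmeyerPanova2017_thm_1_7a)
    (h46 : ikenmeyerPanova2017_thm_4_6) :
    ∀ (n m d : ℕ) [NeZero m] (_hn : 3 ≤ n) (_hnm : 3 * n ^ 4 < m)
      (lam : Nat.Partition (m * d)) (_hlam : lam.parts.card ≤ m * m)
      (_h : Literature.NumberTheory.DiophantineGeometry.HasHighestWeight
        (Complexity.bipPaddedPerOrbitRep ℂ n m) (partitionWeightLex m lam)),
      0 < Literature.NumberTheory.DiophantineGeometry.kroneckerCoeff ℂ lam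
        (Nat.Partition.rectangle m d) (Nat.Partition.rectangle m d) :=
  ikenmeyerPanova2017_thm_1_4_of_three_facts_three_le ikenmeyerPanova2017_prop_2_8_holds h17a h46

/-- **The printed route for `n ≥ 3` from Thm. 1.7(a) and Thm. 1.7(b)** (Cor. 1.6 now a theorem;
the BLMW lift and Kadish–Landsberg being tree theorems): IP's assembly of §1.1,
`ikenmeyerPanova2017_thm_1_4_of_parts'` with `h16` discharged.
[cite: IkenmeyerPanova2017, Thm. 1.4 and §1.1 (Proof of Thm. 1.4; held: Thm. 4, p. 5)] -/
theorem ikenmeyerPanova2017_thm_1_4_of_thm_1_7 (h17a : ikenmeyerPanova2017_thm_1_7a)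
    (h17b : ikenmeyerPanova2017_thm_1_7b) {n m d : ℕ} [NeZero m] (hn : 3 ≤ n) (hnm : 3 * n ^ 4 < m)
    (lam : Nat.Partition (m * d)) (hlam : lam.parts.card ≤ m * m)
    (h : Literature.NumberTheory.DiophantineGeometry.HasHighestWeight
      (Complexity.bipPaddedPerOrbitRep ℂ n m) (partitionWeightLex m lam)) :
    0 < Literature.NumberTheory.DiophantineGeometry.kroneckerCoeff ℂ lam (Nat.Partition.rectangle m d)
      (Nat.Partition.rectangle m d) :=
  ikenmeyerPanova2017_thm_1_4_of_parts' ikenmeyerPanova2017_cor_1_6_holds h17a h17b hn hnm lam hlam h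

/-- **The printed route for `n ≥ 3` from Thm. 1.7(a) and Thm. 4.6** (Thm. 1.7(b) from Thm. 4.6 and
the transposition property as in print, both discharged in the tree).
[cite: IkenmeyerPanova2017, Thm. 1.4 (held: Thm. 4), via Cor. 1.6, Thm. 1.7(a), Thm. 4.6] -/
theorem ikenmeyerPanova2017_thm_1_4_of_two_facts_printed_route (h17a : ikenmeyerPanova2017_thm_1_7a)
    (h46 : ikenmeyerPanova2017_thm_4_6) {n m d : ℕ} [NeZero m] (hn : 3 ≤ n) (hnm : 3 * n ^ 4 < m)
    (lam : Nat.Partition (m * d)) (hlam : lam.parts.card ≤ m * m)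
    (h : Literature.NumberTheory.DiophantineGeometry.HasHighestWeight
      (Complexity.bipPaddedPerOrbitRep ℂ n m) (partitionWeightLex m lam)) :
    0 < Literature.NumberTheory.DiophantineGeometry.kroneckerCoeff ℂ lam (Nat.Partition.rectangle m d)
      (Nat.Partition.rectangle m d) :=
  ikenmeyerPanova2017_thm_1_4_of_thm_1_7 h17a (ikenmeyerPanova2017_thm_1_7b_of_thm_4_6_holds h46) hn
    hnm lam hlam h

/-! ### What the two facts give for G20's fresh-variable padding -/

/-- **Fresh-variable padding at threshold `3·max(n²+1, 9)² ≤ m` from Thm. 1.7(a) and Thm. 4.6**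
(the orbit closure of the tree fact `ikenmeyer_panova_rectangular_kronecker_pos`; not a printed
statement): `kroneckerCoeff_pos_paddedPerOrbitRep_of_three_facts` with Prop. 2.8 discharged.
[cite: IkenmeyerPanova2017, §4 (Proof of Thm. 1.7; held p. 12) and §1.1 (Proof of Thm. 1.4), with ℓ = max(n² + 1, 9)] -/
theorem kroneckerCoeff_pos_paddedPerOrbitRep_of_two_facts (h17a : ikenmeyerPanova2017_thm_1_7a)
    (h46 : ikenmeyerPanova2017_thm_4_6) {n m d : ℕ} [NeZero m] (hnm : 3 * (max (n ^ 2 + 1) 9) ^ 2 ≤ m)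
    (lam : Nat.Partition (m * d)) (hlam : lam.parts.card ≤ m * m)
    (h : Literature.NumberTheory.DiophantineGeometry.HasHighestWeight
      (Literature.NumberTheory.DiophantineGeometry.paddedPerOrbitRep ℂ n m) (partitionWeightLex m lam)) :
    0 < Literature.NumberTheory.DiophantineGeometry.kroneckerCoeff ℂ lam (Nat.Partition.rectangle m d)
      (Nat.Partition.rectangle m d) :=
  kroneckerCoeff_pos_paddedPerOrbitRep_of_three_facts ikenmeyerPanova2017_prop_2_8_holds h17a h46 hnm
    lam hlam h

/-- **Fresh-variable padding at threshold `3(n+1)^4 < m` (`2 ≤ n`) from Thm. 1.7(a) and Thm. 1.7(b)**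
— IP's proof run with parameter `M = n + 1` through Cor. 1.6 (now a theorem); not a printed
statement. [cite: IkenmeyerPanova2017, §1.1 (Proof of Thm. 1.4; held p. 5), with M = n + 1] -/
theorem kroneckerCoeff_pos_paddedPerOrbitRep_of_thm_1_7 (h17a : ikenmeyerPanova2017_thm_1_7a)
    (h17b : ikenmeyerPanova2017_thm_1_7b) {n m d : ℕ} [NeZero m] (hn : 2 ≤ n)
    (hnm : 3 * (n + 1) ^ 4 < m) (lam : Nat.Partition (m * d)) (hlam : lam.parts.card ≤ m * m)
    (h : Literature.NumberTheory.DiophantineGeometry.HasHighestWeight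
      (Literature.NumberTheory.DiophantineGeometry.paddedPerOrbitRep ℂ n m) (partitionWeightLex m lam)) :
    0 < Literature.NumberTheory.DiophantineGeometry.kroneckerCoeff ℂ lam (Nat.Partition.rectangle m d)
      (Nat.Partition.rectangle m d) :=
  kroneckerCoeff_pos_paddedPerOrbitRep_of_parts' ikenmeyerPanova2017_cor_1_6_holds h17a h17b hn hnm
    lam hlam h

end Literature.Computability.Complexity
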